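import Literature.NumberTheory.GaloisRepresentations.ContinuousH2CompatiblePairs
import Literature.NumberTheory.GaloisRepresentations.CyclicLayerFrobeniusClassInflation
import Literature.NumberTheory.GaloisRepresentations.LocalCanonicalFundamentalClassAbstract
import HarnessLib

/-!
# The inflation `H²(Gal(E/K), Eˣ) → H²(K, K̄ˣ)` of an ABSTRACT finite Galois extension as ONE compatible
# pair, and its localisation (Serre, *Galois Cohomology* I §2.4, §2.6; *Local Fields* X §4 Prop. 6)

Topic `NumberTheory/GaloisRepresentations`; namespace `Literature.NumberTheory.GaloisRepresentations`.
Definitions with bodies and theorems; no named fact, no instance, no notation.  Sequel to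
`ContinuousH2CompatiblePairs` (door-c6 g12: `CompatiblePair`, `pull`, conjugation invariance) and to
door-c6 g9/g10's `GaloisCohomologyLayerInflationTwo` / `GaloisCohomologyUnitsLayerInflation` /
`LocalCanonicalFundamentalClassAbstract` (`infTwo`, `unitsInfTwo`, `unitsCohomologyIso`, `layerInv`).

For a field `K : Type` of characteristic `0` and a finite Galois extension `E : Type` of `K` the tree reaches
`H²(K, K̄ˣ)` from the engine's `H²(Gal(E/K), Eˣ) = groupCohomology (Rep.ofAlgebraAutOnUnits K E) 2` by
transport to the embedded copy `E₀ = embeddedField K E ⊆ K̄` (`unitsCohomologyIso (embeddedEquiv K E) 2`)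
followed by `unitsInfTwo K E₀` — inside door-c6's `layerInv K E` (local fields) and below for number fields.
This file names that composite **`unitsAbsInfTwo K E`** and computes it on cocycles as ONE pulled-back
continuous cocycle:

* §1 `inflationPair K L ρ` (`(Γ_K, M) → (Γ_K ⧸ Γ_L, M^{Γ_L})`: `(mk, incl)`), `inflateTwoCocycle_eq_pull`,
  `infTwo_H2π_eq_pull`; `unitsLayerPair K L` (`(Γ_K, K̄ˣ) → (Gal(L/K), Lˣ)` for an embedded layer
  `L ⊆ K̄`), **`unitsInfTwo_H2π`**: `unitsInfTwo K L [c] = [(s,t) ↦ c(s|_L, t|_L) ∈ K̄ˣ]`.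
* §2 `absUnitsResHom`, `absUnitsPair K E` (`(Γ_K, K̄ˣ) → (Gal(E/K), Eˣ)`, module component
  `u ↦ ι_E(u)` for the chosen embedding `ι_E = embeddingToAbs K E : E → K̄`, `absUnitsPair_φ_ofMul`),
  **`unitsAbsInfTwo K E`** (definition with body), `layerInv_eq_brauerInvariantEquiv_unitsAbsInfTwo`
  (door-c6's `layerInv = inv_K ∘ unitsAbsInfTwo`, `rfl`), **`unitsAbsInfTwo_H2π`**
  (`unitsAbsInfTwo K E [b] = [(s,t) ↦ ι_E (b (s|_E, t|_E))]`).
* §3 localisation / restriction to an extension `L/K` (`L : Type`, e.g. a completion): for every morphism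
  `φ : res (K̄ˣ) ⟶ L̄ˣ` over `absGaloisRestrict K L` (the tree's `exists_unitsHom`),
  **`map_unitsAbsInfTwo_H2π`**: `H²(res, φ) (unitsAbsInfTwo K E [b]) = [((absUnitsPair K E).pullback res φ).pull b]`,
  and the module component of that pair is `u ↦ ι(ι_E(u))` (`pullback_absUnitsPair_φ_ofMul`).

With §2 of `ContinuousH2CompatiblePairs` this reduces every comparison "localise the inflated global class"
vs "inflate the local class" to exhibiting an element of `Gal(E/K)` relating two embeddings of `E` — the use
made in `IdeleBrauerLocalInvariantsDictionary` (bsd-schneider cell, Route A, crux `AnticycControlAdditiveK`).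
HONEST FRAMING: homological bookkeeping; no arithmetic statement is proved here.

## References
* J.-P. Serre, *Galois Cohomology* (1997), Ch. I §2.2 Prop. 8, §2.4, §2.6. [SerreGaloisCohomology1997]
* J.-P. Serre, *Local Fields*, GTM 67 (1979), Ch. X §4 Prop. 6 (`Br(L/K) = H²(Gal(L/K), Lˣ)`). [SerreLocalFields1979]
-/

noncomputable section

open CategoryTheory groupCohomology Function Field

namespace Literature.NumberTheory.GaloisRepresentations

open DiscreteGaloisModule Literature.Algebra.Homology

-- Explicit `2`-cocycle classes need `LocallyCompactSpace Γ_K`; the tree's theorem (every field) is the only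
-- source of it.  Local to this file, no override (as in `PoitouTate.lean`).
attribute [local instance] absoluteGaloisGroup_compactSpace

variable (K : Type) [Field K]

/-! ## §1. Inflation from an embedded layer as a compatible pair -/

section Layer

variable (L : IntermediateField K (AlgebraicClosure K)) [FiniteDimensional K L] [Normal K L]
variable {M : Type} [AddCommGroup M] [TopologicalSpace M] [DiscreteTopology M] (ρ : DiscreteGaloisModule K M)

omit [FiniteDimensional K L] in
/-- **The inflation pair `(Γ_K, M) → (Γ_K ⧸ Γ_L, M^{Γ_L})`**: the quotient map and the inclusion of the
invariants. [cite: SerreGaloisCohomology1997, Ch. I §2.2 Prop. 8] -/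
def inflationPair : CompatiblePair (absGaloisLayerRep K L ρ) ρ.toTopRep where
  f := QuotientGroup.mk' (absGaloisFixingSubgroup L)
  isLocallyConstant_f :=
    haveI := discreteTopology_quotient_absGaloisFixingSubgroup K L
    (IsLocallyConstant.iff_continuous _).2 (QuotientGroup.continuous_mk (N := absGaloisFixingSubgroup L))
  φ := { toFun := fun w => (w : M), map_zero' := rfl, map_add' := fun _ _ => rfl }
  comm _ _ := rfl

/-- door-c6 g9's inflated cocycle IS the pull along `inflationPair`. [cite: SerreGaloisCohomology1997, Ch. I §2.2 Prop. 8] -/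
theorem inflateTwoCocycle_eq_pull (f : cocycles₂ (absGaloisLayerRep K L ρ)) :
    inflateTwoCocycle K L ρ f = (inflationPair K L ρ).pull f :=
  Subtype.ext (ContinuousMap.ext fun ⟨_, _⟩ => rfl)

/-- `infTwo [f] = [pull_{inflationPair} f]`. [cite: SerreGaloisCohomology1997, Ch. I §2.2 Prop. 8] -/
theorem infTwo_H2π_eq_pull (f : cocycles₂ (absGaloisLayerRep K L ρ)) :
    infTwo K L ρ (H2π _ f) = twoCocycleClass ρ.toTopRep ((inflationPair K L ρ).pull f) := by
  rw [infTwo_H2π, inflateTwoCocycle_eq_pull]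

end Layer

section UnitsLayer

variable [CharZero K] (L : IntermediateField K (AlgebraicClosure K)) [FiniteDimensional K L] [IsGalois K L]

/-- **The pair `(Γ_K, K̄ˣ) → (Gal(L/K), Lˣ)` of the units layer** (`s ↦ s|_L`, `u ↦ u`): `inflationPair`
composed with the identification `(K̄ˣ)^{Γ_L} = Lˣ` (`unitsLayerInvHom`, door-c6's `unitsLayerEquiv⁻¹`).
[cite: SerreLocalFields1979, Ch. X §4 Prop. 6][cite: SerreGaloisCohomology1997, Ch. I §2.6] -/
def unitsLayerPair : CompatiblePair (Rep.ofAlgebraAutOnUnits K L) (units K).toTopRep :=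
  (inflationPair K L (units K)).compMap _ (unitsLayerInvHom K L)

/-- The module component of `unitsLayerPair`: `u ↦ u ∈ K̄ˣ`. [cite: SerreLocalFields1979, Ch. X §4 Prop. 6] -/
theorem unitsLayerPair_φ_ofMul (u : (L : Type)ˣ) :
    (unitsLayerPair K L).φ (Additive.ofMul u) =
      UnitsCarrier.ofUnits (Units.map (algebraMap L (AlgebraicClosure K) : L →* AlgebraicClosure K) u) := rfl

/-- The group component of `unitsLayerPair`: `s ↦ s|_L` (`resGal`). [cite: SerreGaloisCohomology1997, Ch. I §2.6] -/
theorem unitsLayerPair_f_apply (s : absoluteGaloisGroup K) : (unitsLayerPair K L).f s = resGal L s := rfl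

/-- **The cocycle formula for `unitsInfTwo`: `unitsInfTwo [c] = [(s, t) ↦ c(s|_L, t|_L)]`.**
[cite: SerreLocalFields1979, Ch. X §4 Prop. 6][cite: SerreGaloisCohomology1997, Ch. I §2.2 Prop. 8] -/
theorem unitsInfTwo_H2π (c : cocycles₂ (Rep.ofAlgebraAutOnUnits K L)) :
    unitsInfTwo K L (H2π _ c) = twoCocycleClass (units K).toTopRep ((unitsLayerPair K L).pull c) := by
  rw [← Iso.inv_hom_id_apply (unitsLayerH2Iso K L) (H2π _ _), unitsInfTwo_apply_hom,
    unitsLayerH2Iso_inv_H2π, infTwo_H2π_eq_pull, CompatiblePair.pull_mapCocycles₂]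
  rfl

end UnitsLayer

/-! ## §2. The abstract layer `E/K`: `unitsAbsInfTwo K E : H²(Gal(E/K), Eˣ) → H²(K, K̄ˣ)` -/

section Abs

variable [CharZero K] (E : Type) [Field E] [Algebra K E] [FiniteDimensional K E] [IsGalois K E]

omit [CharZero K] [IsGalois K E] in
/-- `(embeddedEquiv K E x : K̄) = embeddingToAbs K E x` (definitional). [cite: SerreGaloisCohomology1997, Ch. I §2.6] -/
theorem coe_embeddedEquiv (x : E) :
    ((embeddedEquiv K E x : embeddedField K E) : AlgebraicClosure K) = embeddingToAbs K E x := rfl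

/-- **The transport morphism `Res_{e*} (Eˣ) ⟶ E₀ˣ`** along `e = embeddedEquiv K E : E ≃ₐ[K] E₀`
(`e* = autCongr e`; `u ↦ e(u)`) — the morphism underlying `(unitsCohomologyIso e n).hom`.
[cite: SerreLocalFields1979, Ch. XI §1 (iv)] -/
def absUnitsResHom :
    Rep.res ((embeddedEquiv K E).autCongr.symm : (embeddedField K E ≃ₐ[K] embeddedField K E) →* (E ≃ₐ[K] E))
        (Rep.ofAlgebraAutOnUnits K E) ⟶ Rep.ofAlgebraAutOnUnits K (embeddedField K E) :=
  Rep.ofHom ⟨LinearEquiv.toLinearMap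
      (Units.mapEquiv ((embeddedEquiv K E) : E ≃* embeddedField K E)).toAdditive.toIntLinearEquiv,
    fun g => by
      apply LinearMap.ext
      intro x
      refine Additive.toMul.injective (Units.ext ?_)
      -- `e (e⁻¹ (g (e u))) = g (e u)`: both sides unfold to this
      exact (embeddedEquiv K E).apply_symm_apply _⟩

omit [CharZero K] [IsGalois K E] in
/-- `(unitsCohomologyIso (embeddedEquiv K E) n).hom = Hⁿ(e*⁻¹, absUnitsResHom)`.
[cite: SerreLocalFields1979, Ch. XI §1 (iv)] -/
theorem unitsCohomologyIso_embeddedEquiv_hom (n : ℕ) :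
    (UnitsLayer.unitsCohomologyIso (embeddedEquiv K E) n).hom =
      groupCohomology.map _ (absUnitsResHom K E) n := by
  rw [UnitsLayer.unitsCohomologyIso, groupCohomology.mapIso_hom]
  rfl

/-- **The pair `(Γ_K, K̄ˣ) → (Gal(E/K), Eˣ)` of an abstract layer**: `unitsLayerPair` of the embedded copy
composed with the transport `E ≃ E₀`; module component `u ↦ ι_E(u)`, `ι_E = embeddingToAbs K E`.
[cite: SerreGaloisCohomology1997, Ch. I §2.6][cite: SerreLocalFields1979, Ch. X §4 Prop. 6] -/
def absUnitsPair : CompatiblePair (Rep.ofAlgebraAutOnUnits K E) (units K).toTopRep :=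
  (unitsLayerPair K (embeddedField K E)).compMap _ (absUnitsResHom K E)

/-- The module component of `absUnitsPair`: `u ↦ ι_E(u) ∈ K̄ˣ`. [cite: SerreGaloisCohomology1997, Ch. I §2.6] -/
theorem absUnitsPair_φ_ofMul (u : Eˣ) :
    (absUnitsPair K E).φ (Additive.ofMul u) =
      UnitsCarrier.ofUnits (Units.map (embeddingToAbs K E : E →* AlgebraicClosure K) u) :=
  congrArg UnitsCarrier.ofUnits (Units.ext rfl)

/-- **`unitsAbsInfTwo K E : H²(Gal(E/K), Eˣ) →+ H²(K, K̄ˣ)`** — transport to the embedded copy, then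
`unitsInfTwo` (the composite inside door-c6's `layerInv`). [cite: SerreLocalFields1979, Ch. X §4 Prop. 6]
[cite: SerreGaloisCohomology1997, Ch. I §2.6] -/
def unitsAbsInfTwo : groupCohomology (Rep.ofAlgebraAutOnUnits K E) 2 →+ galoisCohomology (units K) 2 :=
  (unitsInfTwo K (embeddedField K E)).comp
    (UnitsLayer.unitsCohomologyIso (embeddedEquiv K E) 2).hom.hom.toAddMonoidHom

/-- Unfolding `unitsAbsInfTwo`. [cite: SerreGaloisCohomology1997, Ch. I §2.6] -/
theorem unitsAbsInfTwo_apply (x : groupCohomology (Rep.ofAlgebraAutOnUnits K E) 2) :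
    unitsAbsInfTwo K E x =
      unitsInfTwo K (embeddedField K E) ((UnitsLayer.unitsCohomologyIso (embeddedEquiv K E) 2).hom x) := rfl

/-- `unitsAbsInfTwo` is injective (transport is an isomorphism, `unitsInfTwo` is injective).
[cite: SerreLocalFields1979, Ch. X §4 Prop. 6] -/
theorem unitsAbsInfTwo_injective : Injective (unitsAbsInfTwo K E) :=
  (unitsInfTwo_injective K (embeddedField K E)).comp
    (UnitsLayer.unitsCohomologyIso_hom_injective (embeddedEquiv K E) 2)

/-- **The cocycle formula `unitsAbsInfTwo [b] = [(s, t) ↦ ι_E (b (s|_E, t|_E))]`.**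
[cite: SerreGaloisCohomology1997, Ch. I §2.2 Prop. 8, §2.6] -/
theorem unitsAbsInfTwo_H2π (b : cocycles₂ (Rep.ofAlgebraAutOnUnits K E)) :
    unitsAbsInfTwo K E (H2π _ b) = twoCocycleClass (units K).toTopRep ((absUnitsPair K E).pull b) := by
  rw [unitsAbsInfTwo_apply, unitsCohomologyIso_embeddedEquiv_hom, H2π_comp_map_apply, unitsInfTwo_H2π,
    CompatiblePair.pull_mapCocycles₂]
  rfl

end Abs

/-! ## §3. Door-c6's local invariant of an abstract layer through `unitsAbsInfTwo`; localisation -/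

section Local

open Literature.AnabelianGeometry.AbsoluteAnabelian.Prop121vii

variable [ValuativeRel K] [TopologicalSpace K] [IsNonarchimedeanLocalField K] [CharZero K]
variable (E : Type) [Field E] [Algebra K E] [FiniteDimensional K E] [IsGalois K E]

/-- **`layerInv K E = inv_K ∘ unitsAbsInfTwo K E`** (definitional unfolding of door-c6 g10's `layerInv`).
[cite: SerreLocalFields1979, Ch. XIII §3] -/
theorem layerInv_eq_brauerInvariantEquiv_unitsAbsInfTwo (x : groupCohomology (Rep.ofAlgebraAutOnUnits K E) 2) :
    UnitsLayer.layerInv K E x = brauerInvariantEquiv K (unitsAbsInfTwo K E x) := rfl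

end Local

section Res

variable [CharZero K] (E : Type) [Field E] [Algebra K E] [FiniteDimensional K E] [IsGalois K E]
variable (L : Type) [Field L] [Algebra K L]

/-- **Restriction / localisation of the inflated class**: along any morphism `φ : res (K̄ˣ) ⟶ L̄ˣ` over
`absGaloisRestrict K L`, `H²(res, φ) (unitsAbsInfTwo K E [b]) = [((absUnitsPair K E).pullback res φ).pull b]`.
[cite: SerreGaloisCohomology1997, Ch. I §2.4, Ch. II §6.1] -/
theorem map_unitsAbsInfTwo_H2π
    (φ : TopRep.res ((absGaloisRestrict K L : absoluteGaloisGroup L →ₜ* absoluteGaloisGroup K) :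
        absoluteGaloisGroup L →* absoluteGaloisGroup K) (units K).toTopRep ⟶ (units L).toTopRep)
    (b : cocycles₂ (Rep.ofAlgebraAutOnUnits K E)) :
    (ContinuousCohomology.map (absGaloisRestrict K L) φ 2).hom (unitsAbsInfTwo K E (H2π _ b)) =
      twoCocycleClass (units L).toTopRep (((absUnitsPair K E).pullback (absGaloisRestrict K L) φ).pull b) := by
  rw [unitsAbsInfTwo_H2π, ← CompatiblePair.pullback_pull]
  exact map_twoCocycleClass (absGaloisRestrict K L) (X := (units K).toTopRep) (Y := (units L).toTopRep) φ _

/-- The module component of the localised pair: `u ↦ φ(ι_E(u))`; for the standard `φ` (`u ↦ ι(u)`,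
`ι = absClosureEmbedding K L`) this is `u ↦ ι(ι_E(u))`. [cite: SerreGaloisCohomology1997, Ch. I §2.4] -/
theorem pullback_absUnitsPair_φ_ofMul
    (φ : TopRep.res ((absGaloisRestrict K L : absoluteGaloisGroup L →ₜ* absoluteGaloisGroup K) :
        absoluteGaloisGroup L →* absoluteGaloisGroup K) (units K).toTopRep ⟶ (units L).toTopRep)
    (hφ : ∀ u : (AlgebraicClosure K)ˣ, φ.hom (UnitsCarrier.ofUnits u) =
      UnitsCarrier.ofUnits (Units.map (absClosureEmbedding K L : AlgebraicClosure K →* AlgebraicClosure L) u))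
    (u : Eˣ) :
    ((absUnitsPair K E).pullback (absGaloisRestrict K L) φ).φ (Additive.ofMul u) =
      UnitsCarrier.ofUnits (Units.map (((absClosureEmbedding K L : AlgebraicClosure K →+* AlgebraicClosure L).comp
        (embeddingToAbs K E : E →+* AlgebraicClosure K)) : E →* AlgebraicClosure L) u) := by
  rw [CompatiblePair.pullback_φ_apply, absUnitsPair_φ_ofMul, hφ]
  exact congrArg UnitsCarrier.ofUnits (Units.ext rfl)

end Res

end Literature.NumberTheory.GaloisRepresentations

end
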